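import Summits.BirchSwinnertonDyer.BirchSwinnertonDyer.Theorems.AdditiveBranchIMCGordTwoRankOneHeegnerKolyvaginTwist
import Summits.BirchSwinnertonDyer.Rank1Residual.X11b.Three.KolyvaginNonvanishing
import HarnessLib

/-!
# Route `AdditiveBranchIMC` (rung K1), crux `GordTwoRankOne` (item 19358): the Heegner–Kolyvagin road,
# Part 17a — the ADJUSTED McCallum certificate door: one Kolyvagin certificate of the BSD-predicted depth
# gives lane B's STEP L′ at the datum (cell `bsd-addord`, second prover lane `bsd-addord-k1-c3x`, gen 3;
# `--supports` only; ROUTE-CONE-FREE: imports no `Theses` file)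

HONEST FRAMING. THEOREMS ONLY: no definition, no new named fact, no `sorry`; nothing is booked; crux 19358
and item 20498 stay OPEN; BSD is not proved by any of this. CONDITIONAL on the tree's cited Kolyvagin–McCallum
fact `McCallum1991_pow_dvd_card_sha_primary_of_certificate` (a binder, never asserted).

WHY. Lane B's residual (Part 8 / item 20498) is the ADJUSTED Heegner-index bound STEP L′:
`2·ord_p[E(K):ℤy_K] ≤ ord_p #Ш(E/K) + ord_p ∏c(E) + ord_p ∏c(Wd) + 2·ord_p c(Dt)` (`Wd` a minimal model of
`E^{d_K}`), the normalisation BSD(E,p) ∧ BSD(E^{d_K},p) predicts WITH EQUALITY. Kolyvagin–McCallum (McCallum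
1991 §5 Lemma 5.1, Cor. 5.6): `ord_p #Ш(E/K)[p^∞] ≥ 2(M₀ − M_∞)` with `M₀ = ord_p[E(K):ℤy_K]` and `M_∞` the
eventual divisibility of the derived classes; so STEP L′ is `M_∞ ≤ ½(ord_p ∏c(E) + ord_p ∏c(Wd)) + ord_p c(Dt)`
and is certified per pair by ONE derived class of that depth. x11b's door
(`Three.Koly.indexLowerBoundAt_of_certificate_of_mccallum`, STEP L `2·ord_p I ≤ ord_p #Ш(E/K) + 2·ord_p ∏c(E)`)
takes depth `M ≤ ord_p ∏c(E)` — NOT what BSD predicts on the data with `ord_p ∏c(Wd) ≠ ord_p ∏c(E)` (p = 3,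
`2 ∣ d_K`) or `p ∣ c(Dt)`. This file: the door at the ADJUSTED depth `2M ≤ ord_p ∏c(E) + ord_p ∏c(Wd) +
2·ord_p c(Dt)` (§22a), and its `M = 0` case from a NON-ZERO class `c₁(n)` of Kolyvagin-prime support —
W. Zhang's mod-`p` form of Kolyvagin's conjecture, the conclusion shape of route `AdditiveKolyvaginRoad`'s
crux `KolyvaginPrimitiveAdditive` (§22b; consumed by Part 17b `…HeegnerKolyvaginHorizontal`).

References: [McCallumLMS1991] §5 Lemma 5.1, Cor. 5.6; [Kolyvagin1991]; [WZhang2014] Thm. 10.2, Remark 5;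
[JetchevSkinnerWan2017] §7.4.1; [GrossZagier1986] V.§2.
-/

set_option autoImplicit false
set_option linter.dupNamespace false
noncomputable section
open scoped Classical NumberField
open WeierstrassCurve NumberField IsDedekindDomain Literature.NumberTheory.EllipticCurves
  Literature.NumberTheory.EllipticCurves.ModularForms Literature.NumberTheory.EllipticCurves.Rank1Residual
  Summit.BirchSwinnertonDyer.Rank1Residual Summit.BirchSwinnertonDyer.Rank1Residual.X11b

namespace Summit.BirchSwinnertonDyer.BirchSwinnertonDyer.Theorems.AdditiveBranchIMCGordTwoRankOne.HeegnerKolyvagin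

/-! ### §22 The ADJUSTED McCallum door (pointwise): a certificate of the BSD-predicted depth gives STEP L′ -/

/-- **STEP L′ at a datum from ONE Kolyvagin certificate of ADJUSTED depth (McCallum 1991 Cor. 5.6).**
Frame of the cited Kolyvagin–McCallum fact (`hMc`): `W/ℚ` globally minimal non-CM, `K` imaginary
quadratic Heegner for `N_E` with `d_K ∉ {−3,−4}`, `p` odd with `ρ̄_{E,p^m}` onto for all `m`, the
conductor-`1` datum `d₁` with `P_1 = y_K = P ∈ E(K)` of infinite order, `E(K)` of rank one without
`p`-torsion, `Ш(E/K)` finite, `p^{M₀} ∥ P`. CERTIFICATE: a datum `d` of square-free conductor `n` (prime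
factors Kolyvagin primes of index `≥ M + 1`) with `P_n ∉ p^{M+1}E(K[n])`, and DEPTH CONDITION
`2M ≤ ord_p ∏c(E) + ord_p ∏c(Wd) + 2·ord_p c(Dt)` (`Wd` any curve; at a twist model the BSD-predicted
`2M_∞`). CONCLUSION: `2·ord_p[E(K):ℤP] ≤ ord_p #Ш(E/K) + ord_p ∏c(E) + ord_p ∏c(Wd) + 2·ord_p c(Dt)`
(`2M₀ − 2M ≤ ord_p #Ш(E/K)` by the fact, `ord_p[E(K):ℤP] = M₀` by Lemma 5.1; x11b's door has depth
`M ≤ ord_p ∏c(E)`). CONDITIONAL on `hMc`. [cite: McCallumLMS1991, §5 Lemma 5.1 (p. 303) and Cor. 5.6 (p. 310)]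
[cite: JetchevSkinnerWan2017, §7.4.1 (pp. 30–31)] -/
theorem adjustedIndexBound_of_certificate_of_mccallum
    (hMc : McCallum1991_pow_dvd_card_sha_primary_of_certificate)
    (W : WeierstrassCurve ℚ) [W.IsElliptic] [W.IsGloballyMinimal] [NeZero (W.conductorNorm ℤ)]
    (hCM : ¬ W.HasCM) (K : Type) [Field K] [NumberField K] (hK : IsImaginaryQuadratic K)
    (h3 : NumberField.discr K ≠ -3) (h4 : NumberField.discr K ≠ -4)
    (hH : SatisfiesHeegnerHypothesis (W.conductorNorm ℤ) K)
    (p : ℕ) [Fact p.Prime] (hp2 : p ≠ 2) (hsurj : ∀ m : ℕ, W.HasSurjectiveModNGaloisRep (p ^ m : ℕ))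
    (Dt : ModularParametrizationData W (W.conductorNorm ℤ)) (β : ℤ) (ι : K →+* ℂ)
    (d₁ : KolyvaginHeegnerData Dt β ι 1) (P : (W.baseChange K).toAffine.Point)
    (hPd : d₁.toGeomPoints d₁.derivedPoint = toGeomPoints (W.baseChange K) P)
    (hPinf : ¬ IsOfFinAddOrder P)
    (hrank : (W.baseChange K).mordellWeilRank = 1)
    (hiv : ∀ x : (W.baseChange K).toAffine.Point, p • x = 0 → x = 0)
    [Finite (W.baseChange K).sha] {M₀ : ℕ}
    (hdiv : ∃ Q : (W.baseChange K).toAffine.Point, ((p ^ M₀ : ℕ) : ℤ) • Q = P)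
    (hndiv : ¬ ∃ Q : (W.baseChange K).toAffine.Point, ((p ^ (M₀ + 1) : ℕ) : ℤ) • Q = P)
    {n M : ℕ} (d : KolyvaginHeegnerData Dt β ι n) (hn : Squarefree n)
    (hℓ : ∀ ℓ ∈ n.primeFactors, Zhang2014.IsKolyvaginPrime (W.conductorNorm ℤ) W K p ℓ ∧
      M + 1 ≤ Zhang2014.kolyvaginIndex W p ℓ)
    (hcert : ¬ Three.Koly.PDiv d p (M + 1))
    (Wd : WeierstrassCurve ℚ)
    (hM : (2 * M : ℤ) ≤ padicValNat p W.tamagawaProduct + padicValNat p Wd.tamagawaProduct +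
      2 * padicValRat p (Dt.c : ℚ)) :
    (2 * padicValNat p (AddSubgroup.zmultiples P).index : ℤ) ≤
      padicValNat p (W.baseChange K).shaOrder + padicValNat p W.tamagawaProduct +
        padicValNat p Wd.tamagawaProduct + 2 * padicValRat p (Dt.c : ℚ) := by
  have hle : 2 * (M₀ - M) ≤
      padicValNat p (Nat.card (AddCommGroup.primaryComponent (W.baseChange K).sha p)) :=
    two_mul_sub_le_padicValNat_card_sha_primary_of_certificate hMc W hCM K hK h3 h4 hH p hp2 hsurj
      Dt β ι d₁ P hPd hPinf hdiv hndiv d hn hℓ hcert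
  have hsha : padicValNat p (W.baseChange K).shaOrder =
      padicValNat p (Nat.card (AddCommGroup.primaryComponent (W.baseChange K).sha p)) :=
    Three.Koly.padicValNat_shaOrder_eq (W.baseChange K) p
  haveI : Finite (AddCommGroup.torsion (W.baseChange K).toAffine.Point) :=
    WeierstrassCurve.finite_torsion_point (W := W.baseChange K)
  obtain ⟨c, Q, hcQ, hcker⟩ :=
    RankOne.exists_coord_of_mordellWeilRank_eq_one (W.baseChange K) hrank
  have hidx : padicValNat p (AddSubgroup.zmultiples P).index = M₀ :=
    Three.Koly.padicValNat_index_zmultiples_eq_of_divisibility c Q hcQ hcker hiv P hdiv hndiv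
  have e1 : (2 * M₀ : ℤ) ≤ padicValNat p (W.baseChange K).shaOrder + 2 * M := by
    rw [hsha]; omega
  rw [hidx]
  linarith

/-- **STEP L′ at a datum from a NON-ZERO Kolyvagin class `c₁(n)` of Kolyvagin-prime support (`M_∞ = 0`,
W. Zhang's mod-`p` form of Kolyvagin's conjecture), every odd `p`, NO Tamagawa / Manin hypothesis.**
Same frame; the class gives x11b's `IndexLowerBoundAt W p K P` (`Three.Koly.…_of_mccallum`), which implies
the ADJUSTED bound at a twist model `Wd` (Part 1: `ord_p ∏c(E) ≤ ord_p ∏c(Wd)`; `ord_p c(Dt) ≥ 0`). CONDITIONAL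
on `hMc`. [cite: WZhang2014, Remark 5 and Thm. 10.2 (p. 199)] [cite: McCallumLMS1991, §5 Cor. 5.6 (p. 310)] -/
theorem adjustedIndexBound_of_kolyvaginClass_ne_zero_of_mccallum
    (hMc : McCallum1991_pow_dvd_card_sha_primary_of_certificate)
    (W : WeierstrassCurve ℚ) [W.IsElliptic] [W.IsGloballyMinimal] [NeZero (W.conductorNorm ℤ)]
    (hCM : ¬ W.HasCM) (K : Type) [Field K] [NumberField K] (hK : IsImaginaryQuadratic K)
    (h3 : NumberField.discr K ≠ -3) (h4 : NumberField.discr K ≠ -4)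
    (hH : SatisfiesHeegnerHypothesis (W.conductorNorm ℤ) K)
    (p : ℕ) [hp : Fact p.Prime] (hp2 : p ≠ 2) (hsurj : ∀ m : ℕ, W.HasSurjectiveModNGaloisRep (p ^ m : ℕ))
    (Dt : ModularParametrizationData W (W.conductorNorm ℤ)) (β : ℤ) (ι : K →+* ℂ)
    (d₁ : KolyvaginHeegnerData Dt β ι 1) (P : (W.baseChange K).toAffine.Point)
    (hPd : d₁.toGeomPoints d₁.derivedPoint = toGeomPoints (W.baseChange K) P)
    (hPinf : ¬ IsOfFinAddOrder P)
    (hrank : (W.baseChange K).mordellWeilRank = 1)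
    (hiv : ∀ x : (W.baseChange K).toAffine.Point, p • x = 0 → x = 0)
    [Finite (W.baseChange K).sha] {M₀ : ℕ}
    (hdiv : ∃ Q : (W.baseChange K).toAffine.Point, ((p ^ M₀ : ℕ) : ℤ) • Q = P)
    (hndiv : ¬ ∃ Q : (W.baseChange K).toAffine.Point, ((p ^ (M₀ + 1) : ℕ) : ℤ) • Q = P)
    {n : ℕ} (d : KolyvaginHeegnerData Dt β ι n)
    (hn : KolyvaginDescent.KolSupp (Zhang2014.IsKolyvaginPrime (W.conductorNorm ℤ) W K p) n)
    (hne : d.kolyvaginClass hp.out 1 ≠ 0)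
    {Wd : WeierstrassCurve ℚ} [Wd.IsElliptic] (Cd : VariableChange ℚ)
    (hWd : Cd • W.quadraticTwist (NumberField.discr K : ℚ) = Wd) :
    (2 * padicValNat p (AddSubgroup.zmultiples P).index : ℤ) ≤
      padicValNat p (W.baseChange K).shaOrder + padicValNat p W.tamagawaProduct +
        padicValNat p Wd.tamagawaProduct + 2 * padicValRat p (Dt.c : ℚ) := by
  have hL : IndexLowerBoundAt W p K P :=
    Three.Koly.indexLowerBoundAt_of_kolyvaginClass_one_ne_zero_of_mccallum W K hMc hCM hK h3 h4 hH p hp2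
      hsurj Dt β ι d₁ P hPd hPinf hrank hiv hdiv hndiv d hn hne
  unfold IndexLowerBoundAt at hL
  have e1 : (2 * padicValNat p (AddSubgroup.zmultiples P).index : ℤ) ≤
      padicValNat p (W.baseChange K).shaOrder + 2 * padicValNat p W.tamagawaProduct := by
    exact_mod_cast hL
  have e2 : (padicValNat p W.tamagawaProduct : ℤ) ≤ padicValNat p Wd.tamagawaProduct := by
    exact_mod_cast padicValNat_tamagawaProduct_le_twist_of_heegner W p K hK hH Cd hWd
  have e3 : (0 : ℤ) ≤ padicValRat p (Dt.c : ℚ) := by rw [padicValRat.of_int]; positivity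
  linarith

end Summit.BirchSwinnertonDyer.BirchSwinnertonDyer.Theorems.AdditiveBranchIMCGordTwoRankOne.HeegnerKolyvagin

end
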